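import Mathlib
import Summits.ResolutionOfSingularities.ResolutionOfSingularities.Theses.PAlteration
import Literature.AlgebraicGeometry.Resolution.ResolutionLU
import Literature.AlgebraicGeometry.Resolution.ResolutionOfCurves
import Literature.AlgebraicGeometry.Resolution.ProjectiveSpaceRegular
import Literature.AlgebraicGeometry.Resolution.ResolutionOfComponents

/-!
# ResolutionOfSingularities / pAlteration — `PicoverLocalModel`: transfer package and known cases
(supports stmt-ResolutionOfSingularities-0557)

Route `pAlteration`, crux `PicoverLocalModel` (rank 5): for a prime `p`, a field `k` of
characteristic `p`, a regular finitely generated `k`-domain `R` and `a ∈ R`, the reduced scheme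
`X_a := Spec ((R[T]/(T^p - a))_red)` — the `α_p`-torsor / purely inseparable hypersurface `t^p = a`
over the regular affine base `Spec R` (Temkin 2013, Rem. 1.3.5(ii)–(iii)) — has a resolution of
singularities. The general statement is the open "inseparable case" of resolution in positive
characteristic (open from `dim R = 4` on). This file lands the part of the crux that IS known,
as helper theorems every line of attack on the crux has to pass through:

* the algebra of `A_a := R[T]/(T^p - a) = AdjoinRoot (X ^ p - C a)` in characteristic `p`:
  `x ^ p ∈ R` for every `x : A_a` (`pow_mem_range_of_adjoinRoot_X_pow_sub_C`), hence the nilradical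
  of `A_a` is prime when `R` is a domain (`isPrime_nilradical_adjoinRoot_X_pow_sub_C`), so `X_a` is
  INTEGRAL, finite over `Spec R`, and `R → (A_a)_red` is injective;
* the transfer to the tree's resolution statements: `(A_a)_red` is a reduced finitely generated
  `k`-algebra of Krull dimension `≤ dim R`, so `ResolutionOverUpToDim k d` with `dim R ≤ d` resolves
  `X_a` (`hasResolution_localModel_of_resolutionOverUpToDim`), and so does `ResolutionInChar p`
  (the summit statement in characteristic `p` implies the crux: `hasResolution_localModel_of_resolutionInChar`);
* the KNOWN CASES: `dim R ≤ 1` unconditionally (curves, in-tree `resolutionOverUpToDim_one`);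
  `dim R ≤ 3` from the named fact `CossartPiltant2019` (Cossart–Piltant 2019, Thm. 1.1 — the best
  published result); and the degenerate case `a = b ^ p` in all dimensions (`X_a ≅ Spec R` is regular).

What is NOT here: the crux itself for `dim R ≥ 4` (open problem); no statement item is restated.
-/

-- `Summit.<Summit>.<Sub>.Theorems` with `Sub = Summit` (single-conjunct summit, D-0017): the
-- duplicated namespace component is the tree layout.
set_option linter.dupNamespace false

namespace Summit.ResolutionOfSingularities.ResolutionOfSingularities.Theorems

open Polynomial AlgebraicGeometry CategoryTheory Literature.AlgebraicGeometry.Resolution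

universe u

/-! ## The algebra `R[T]/(T^p - a)` in characteristic `p` -/

section Algebra

variable {p : ℕ} [hp : Fact p.Prime] {R : Type u} [CommRing R]

omit hp in
/-- In characteristic `p`, `T ^ p = a` in `R[T]/(T^p - a)`: the class of `T` is a `p`-th root of
`a`. [folklore] -/
theorem root_X_pow_sub_C_pow (a : R) :
    AdjoinRoot.root (X ^ p - C a) ^ p = AdjoinRoot.of (X ^ p - C a) a := by
  have h := AdjoinRoot.aeval_eq (f := X ^ p - C a) (X ^ p - C a)
  rw [AdjoinRoot.mk_self, map_sub, map_pow, aeval_X, aeval_C, AdjoinRoot.algebraMap_eq,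
    sub_eq_zero] at h
  exact h

/-- **Frobenius lands in the base**: in characteristic `p`, for every element `x` of
`A_a = R[T]/(T^p - a)` the power `x ^ p` lies in (the image of) `R` — if `x` is the class of
`q(T)` then `x ^ p` is the class of `q^{(p)}(T^p) = q^{(p)}(a)`, `q^{(p)}` the polynomial with
`p`-th-power coefficients. [folklore] -/
theorem pow_mem_range_of_adjoinRoot_X_pow_sub_C [CharP R p] (a : R)
    (x : AdjoinRoot (X ^ p - C a)) : x ^ p ∈ (AdjoinRoot.of (X ^ p - C a)).range := by
  induction x using AdjoinRoot.induction_on with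
  | ih q =>
    refine ⟨(q.map (frobenius R p)).eval a, ?_⟩
    have hq : q ^ p = expand R p (q.map (frobenius R p)) := by
      rw [← map_expand, map_frobenius_expand]
    rw [← map_pow, hq, ← AdjoinRoot.aeval_eq, expand_aeval, root_X_pow_sub_C_pow,
      ← AdjoinRoot.algebraMap_eq, aeval_algebraMap_apply, coe_aeval_eq_eval]

/-- The degree of `X ^ p - C a` is the prime `p`, in particular nonzero. [folklore] -/
theorem degree_X_pow_sub_C_ne_zero [Nontrivial R] (a : R) : (X ^ p - C a : R[X]).degree ≠ 0 := by
  rw [degree_X_pow_sub_C hp.out.pos]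
  exact_mod_cast hp.out.ne_zero

/-- **The nilradical of `R[T]/(T^p - a)` is prime** for a domain `R` of characteristic `p`: if
`x y` is nilpotent then `(x^n)^p (y^n)^p = 0` holds in the domain `R ⊆ A_a`, so a power of `x` or of
`y` vanishes. Hence `(R[T]/(T^p - a))_red` is a domain. [folklore] -/
theorem isPrime_nilradical_adjoinRoot_X_pow_sub_C [IsDomain R] [CharP R p] (a : R) :
    (nilradical (AdjoinRoot (X ^ p - C a))).IsPrime := by
  haveI := AdjoinRoot.nontrivial (X ^ p - C a) (degree_X_pow_sub_C_ne_zero a)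
  have hinj := AdjoinRoot.of.injective_of_degree_ne_zero (degree_X_pow_sub_C_ne_zero (p := p) a)
  refine ⟨?_, ?_⟩
  · intro h
    have h1 : (1 : AdjoinRoot (X ^ p - C a)) ∈ nilradical (AdjoinRoot (X ^ p - C a)) := h ▸ trivial
    rw [mem_nilradical] at h1
    obtain ⟨n, hn⟩ := h1
    exact one_ne_zero ((one_pow n).symm.trans hn)
  · intro x y hxy
    rw [mem_nilradical] at hxy
    obtain ⟨n, hn⟩ := hxy
    obtain ⟨r, hr⟩ := pow_mem_range_of_adjoinRoot_X_pow_sub_C a (x ^ n)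
    obtain ⟨s, hs⟩ := pow_mem_range_of_adjoinRoot_X_pow_sub_C a (y ^ n)
    have hrs : AdjoinRoot.of (X ^ p - C a) (r * s) = AdjoinRoot.of (X ^ p - C a) 0 := by
      rw [map_mul, hr, hs, ← mul_pow, ← mul_pow, hn, zero_pow hp.out.ne_zero, map_zero]
    rcases mul_eq_zero.mp (hinj hrs) with h0 | h0
    · refine Or.inl (mem_nilradical.mpr ⟨n * p, ?_⟩)
      rw [pow_mul, ← hr, h0, map_zero]
    · refine Or.inr (mem_nilradical.mpr ⟨n * p, ?_⟩)
      rw [pow_mul, ← hs, h0, map_zero]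

/-- `(R[T]/(T^p - a))_red` is a domain for a domain `R` of characteristic `p` (so the local model
`X_a` of `PicoverLocalModel` is an integral scheme). [folklore] -/
theorem isDomain_adjoinRoot_X_pow_sub_C_quotient_nilradical [IsDomain R] [CharP R p] (a : R) :
    IsDomain (AdjoinRoot (X ^ p - C a) ⧸ nilradical (AdjoinRoot (X ^ p - C a))) :=
  (Ideal.Quotient.isDomain_iff_prime _).mpr (isPrime_nilradical_adjoinRoot_X_pow_sub_C a)

/-- `R → (R[T]/(T^p - a))_red` is injective for a domain `R` (a constant that is nilpotent in
`A_a ⊇ R` is a nilpotent element of `R`). [folklore] -/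
theorem algebraMap_quotient_nilradical_injective [IsDomain R] (a : R) :
    Function.Injective (algebraMap R
      (AdjoinRoot (X ^ p - C a) ⧸ nilradical (AdjoinRoot (X ^ p - C a)))) := by
  have hinj := AdjoinRoot.of.injective_of_degree_ne_zero (degree_X_pow_sub_C_ne_zero (p := p) a)
  rw [injective_iff_map_eq_zero]
  intro r hr
  rw [← Ideal.Quotient.mk_algebraMap, Ideal.Quotient.eq_zero_iff_mem, mem_nilradical,
    AdjoinRoot.algebraMap_eq] at hr
  obtain ⟨n, hn⟩ := hr
  rw [← map_pow, ← map_zero (AdjoinRoot.of (X ^ p - C a))] at hn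
  exact IsNilpotent.eq_zero ⟨n, hinj hn⟩

/-- `R[T]/(T^p - a)` is a finite `R`-module (free of rank `p` on `1, T, …, T^{p-1}`). [folklore] -/
theorem finite_adjoinRoot_X_pow_sub_C (a : R) : Module.Finite R (AdjoinRoot (X ^ p - C a)) :=
  (monic_X_pow_sub_C a hp.out.ne_zero).finite_adjoinRoot

/-- `(R[T]/(T^p - a))_red` is a finite `R`-module. [folklore] -/
theorem finite_adjoinRoot_X_pow_sub_C_quotient_nilradical (a : R) :
    Module.Finite R (AdjoinRoot (X ^ p - C a) ⧸ nilradical (AdjoinRoot (X ^ p - C a))) := by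
  haveI := finite_adjoinRoot_X_pow_sub_C (p := p) a
  infer_instance

omit hp in
/-- `(R[T]/(T^p - a))_red` is reduced. [folklore] -/
theorem isReduced_adjoinRoot_X_pow_sub_C_quotient_nilradical (a : R) :
    IsReduced (AdjoinRoot (X ^ p - C a) ⧸ nilradical (AdjoinRoot (X ^ p - C a))) :=
  (Ideal.isRadical_iff_quotient_reduced _).mp (Ideal.radical_isRadical _)

/-- **`dim (R[T]/(T^p - a))_red ≤ dim R`**: a quotient of an integral (finite) extension of `R`
(incomparability, `Ideal.IsIntegral.comap_lt_comap`). [folklore] -/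
theorem ringKrullDim_adjoinRoot_X_pow_sub_C_quotient_nilradical_le (a : R) :
    ringKrullDim (AdjoinRoot (X ^ p - C a) ⧸ nilradical (AdjoinRoot (X ^ p - C a))) ≤
      ringKrullDim R := by
  haveI := finite_adjoinRoot_X_pow_sub_C (p := p) a
  refine (ringKrullDim_quotient_le _).trans ?_
  exact Order.krullDim_le_of_strictMono
    (fun q : PrimeSpectrum (AdjoinRoot (X ^ p - C a)) =>
      PrimeSpectrum.comap (algebraMap R (AdjoinRoot (X ^ p - C a))) q)
    (fun q q' h => Ideal.IsIntegral.comap_lt_comap (R := R) h)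

end Algebra

/-! ## Transfer: the local model as a reduced affine `k`-scheme of finite type -/

section Transfer

variable {p : ℕ} [hp : Fact p.Prime] {R : Type u} [CommRing R]

/-- **Transfer.** Weak resolution over `k` up to dimension `d` resolves the local model
`Spec ((R[T]/(T^p - a))_red)` for every finitely generated `k`-algebra `R` of Krull dimension `≤ d`
and every `a ∈ R`: the coordinate ring is a reduced finitely generated `k`-algebra of dimension
`≤ dim R ≤ d` (`ResolutionOverUpToDim.hasResolution_spec`). [folklore] -/
theorem hasResolution_localModel_of_resolutionOverUpToDim (k : Type u) [Field k] [Algebra k R]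
    [Algebra.FiniteType k R] {d : ℕ} (h : ResolutionOverUpToDim k d) (hdim : ringKrullDim R ≤ d)
    (a : R) :
    Scheme.HasResolution (Spec (.of
      (AdjoinRoot (X ^ p - C a) ⧸ nilradical (AdjoinRoot (X ^ p - C a))))) := by
  haveI := isReduced_adjoinRoot_X_pow_sub_C_quotient_nilradical (p := p) a
  haveI : Algebra.FiniteType k
      (AdjoinRoot (X ^ p - C a) ⧸ nilradical (AdjoinRoot (X ^ p - C a))) := inferInstance
  exact h.hasResolution_spec _
    ((ringKrullDim_adjoinRoot_X_pow_sub_C_quotient_nilradical_le (p := p) a).trans hdim)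

omit hp in
/-- **Transfer to the summit statement**: resolution in characteristic `p` (`ResolutionInChar p`,
the summit conjunct at `p`) resolves every local model `Spec ((R[T]/(T^p - a))_red)` over a field of
characteristic `p` — the crux `PicoverLocalModel` is implied by the summit, in every dimension.
[folklore] -/
theorem hasResolution_localModel_of_resolutionInChar (k : Type u) [Field k] [CharP k p] [Algebra k R]
    [Algebra.FiniteType k R] (h : ResolutionInChar.{u} p) (a : R) :
    Scheme.HasResolution (Spec (.of
      (AdjoinRoot (X ^ p - C a) ⧸ nilradical (AdjoinRoot (X ^ p - C a))))) := by
  haveI := isReduced_adjoinRoot_X_pow_sub_C_quotient_nilradical (p := p) a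
  haveI : Algebra.FiniteType k
      (AdjoinRoot (X ^ p - C a) ⧸ nilradical (AdjoinRoot (X ^ p - C a))) := inferInstance
  exact h.hasResolution_spec (k := k) _

/-- **Known case `dim R ≤ 1` (curves), unconditional**: the local model over a finitely generated
`k`-algebra of dimension `≤ 1` has a resolution (normalisation of reduced curves, in-tree
`resolutionOverUpToDim_one`). [folklore] -/
theorem hasResolution_localModel_of_ringKrullDim_le_one (k : Type u) [Field k] [Algebra k R]
    [Algebra.FiniteType k R] (hdim : ringKrullDim R ≤ 1) (a : R) :
    Scheme.HasResolution (Spec (.of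
      (AdjoinRoot (X ^ p - C a) ⧸ nilradical (AdjoinRoot (X ^ p - C a))))) :=
  hasResolution_localModel_of_resolutionOverUpToDim k (resolutionOverUpToDim_one k)
    (by exact_mod_cast hdim) a

/-- **Known case `dim R ≤ 3`, from Cossart–Piltant** (2019, Thm. 1.1: reduced separated
quasi-excellent schemes of dimension `≤ 3` have a resolution; named fact `CossartPiltant2019`):
the local model `Spec ((R[T]/(T^p - a))_red)` over a finitely generated `k`-algebra `R` with
`dim R ≤ 3` has a resolution. This is the best published case of the crux `PicoverLocalModel`;
`dim R ≥ 4` is open. [cite: CossartPiltant2019, Thm. 1.1] -/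
theorem hasResolution_localModel_of_cossartPiltant2019 (k : Type u) [Field k] [Algebra k R]
    [Algebra.FiniteType k R] (h : CossartPiltant2019.{u}) (hdim : ringKrullDim R ≤ 3) (a : R) :
    Scheme.HasResolution (Spec (.of
      (AdjoinRoot (X ^ p - C a) ⧸ nilradical (AdjoinRoot (X ^ p - C a))))) :=
  hasResolution_localModel_of_resolutionOverUpToDim k (cossartPiltant2019_iff.mp h k)
    (by exact_mod_cast hdim) a

end Transfer

/-! ## The degenerate case `a = b ^ p` -/

section PthPower

variable {p : ℕ} [hp : Fact p.Prime] {R : Type u} [CommRing R]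

/-- If `a = b ^ p` then `T ≡ b` modulo the nilradical of `R[T]/(T^p - a)` (indeed
`(T - b)^p = T^p - b^p = 0`), so `R → (R[T]/(T^p - a))_red` is surjective. [folklore] -/
theorem algebraMap_quotient_nilradical_surjective_of_eq_pow [IsDomain R] [CharP R p] {a b : R}
    (hab : a = b ^ p) :
    Function.Surjective (algebraMap R
      (AdjoinRoot (X ^ p - C a) ⧸ nilradical (AdjoinRoot (X ^ p - C a)))) := by
  haveI := AdjoinRoot.nontrivial (X ^ p - C a) (degree_X_pow_sub_C_ne_zero a)
  haveI : CharP (AdjoinRoot (X ^ p - C a)) p :=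
    charP_of_injective_ringHom
      (AdjoinRoot.of.injective_of_degree_ne_zero (degree_X_pow_sub_C_ne_zero (p := p) a)) p
  have hnil : AdjoinRoot.root (X ^ p - C a) - AdjoinRoot.of (X ^ p - C a) b ∈
      nilradical (AdjoinRoot (X ^ p - C a)) := by
    refine mem_nilradical.mpr ⟨p, ?_⟩
    rw [sub_pow_char, root_X_pow_sub_C_pow, ← map_pow, ← hab, sub_self]
  have hroot : Ideal.Quotient.mk (nilradical (AdjoinRoot (X ^ p - C a)))
      (AdjoinRoot.root (X ^ p - C a)) = algebraMap R _ b := by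
    rw [← Ideal.Quotient.mk_algebraMap, AdjoinRoot.algebraMap_eq, Ideal.Quotient.eq]
    exact hnil
  intro x
  obtain ⟨y, rfl⟩ := Ideal.Quotient.mk_surjective x
  obtain ⟨q, rfl⟩ := AdjoinRoot.mk_surjective y
  refine ⟨q.eval b, ?_⟩
  rw [← AdjoinRoot.aeval_eq, ← Ideal.Quotient.mkₐ_eq_mk R, ← aeval_algHom_apply,
    Ideal.Quotient.mkₐ_eq_mk, hroot, aeval_algebraMap_apply, coe_aeval_eq_eval]

/-- **The degenerate case of the local model**: if `a = b ^ p` is a `p`-th power in the domain `R`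
of characteristic `p`, then `R ≃ (R[T]/(T^p - a))_red` (`T ↦ b`): the reduced local model IS the
base. [folklore] -/
theorem algebraMap_quotient_nilradical_bijective_of_eq_pow [IsDomain R] [CharP R p] {a b : R}
    (hab : a = b ^ p) :
    Function.Bijective (algebraMap R
      (AdjoinRoot (X ^ p - C a) ⧸ nilradical (AdjoinRoot (X ^ p - C a)))) :=
  ⟨algebraMap_quotient_nilradical_injective a,
    algebraMap_quotient_nilradical_surjective_of_eq_pow hab⟩

/-- **`PicoverLocalModel` when `a` is a `p`-th power** (all dimensions): for a regular domain `R`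
of characteristic `p` and `a = b ^ p`, `Spec ((R[T]/(T^p - a))_red) ≅ Spec R` is regular, hence
is its own resolution. [folklore] -/
theorem hasResolution_localModel_of_eq_pow [IsDomain R] [CharP R p] [IsRegularRing R] {a b : R}
    (hab : a = b ^ p) :
    Scheme.HasResolution (Spec (.of
      (AdjoinRoot (X ^ p - C a) ⧸ nilradical (AdjoinRoot (X ^ p - C a))))) := by
  let e := RingEquiv.ofBijective _ (algebraMap_quotient_nilradical_bijective_of_eq_pow hab)
  haveI : IsRegularRing (CommRingCat.of R) := ‹IsRegularRing R›
  exact Scheme.HasResolution.of_iso (Spec.map e.symm.toCommRingCatIso.hom)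
    (Scheme.isRegular_Spec (.of R)).hasResolution

end PthPower

/-! ## Corollaries in the binder form of the crux `PicoverLocalModel` -/

section Crux

/-- A nontrivial algebra over a field of characteristic `p` has characteristic `p`. [folklore] -/
theorem charP_of_algebra_field {p : ℕ} (k : Type u) [Field k] [CharP k p] (R : Type u) [CommRing R]
    [Nontrivial R] [Algebra k R] : CharP R p :=
  charP_of_injective_algebraMap (algebraMap k R).injective p

/-- **`PicoverLocalModel` in dimension `≤ 3`, from Cossart–Piltant 2019** (Thm. 1.1, named fact
`CossartPiltant2019`): the crux statement with the extra hypothesis `dim R ≤ 3` — for `k` of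
characteristic `p`, `R` a regular finitely generated `k`-domain of Krull dimension `≤ 3` and `a ∈ R`,
`Spec ((R[T]/(T^p - a))_red)` has a resolution. (Regularity of `R` is not used; `dim R ≥ 4` is
the open case of the crux.) [cite: CossartPiltant2019, Thm. 1.1] -/
theorem picoverLocalModel_of_cossartPiltant2019_of_ringKrullDim_le_three
    (h : CossartPiltant2019.{0}) :
    ∀ p : ℕ, p.Prime → ∀ (k : Type) [Field k] [CharP k p] (R : Type) [CommRing R] [IsDomain R]
      [Algebra k R], Algebra.FiniteType k R → IsRegularRing R → ringKrullDim R ≤ 3 → ∀ a : R,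
      Literature.AlgebraicGeometry.Resolution.Scheme.HasResolution (AlgebraicGeometry.Spec (.of
        (AdjoinRoot (Polynomial.X ^ p - Polynomial.C a) ⧸
          nilradical (AdjoinRoot (Polynomial.X ^ p - Polynomial.C a))))) := by
  intro p hp k _ _ R _ _ _ _ _ hdim a
  haveI : Fact p.Prime := ⟨hp⟩
  exact hasResolution_localModel_of_cossartPiltant2019 k h hdim a

/-- **`PicoverLocalModel` in dimension `≤ 1`, unconditionally** (reduced curves over a field are
resolved by normalisation): the crux statement with the extra hypothesis `dim R ≤ 1`. [folklore] -/
theorem picoverLocalModel_of_ringKrullDim_le_one :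
    ∀ p : ℕ, p.Prime → ∀ (k : Type) [Field k] [CharP k p] (R : Type) [CommRing R] [IsDomain R]
      [Algebra k R], Algebra.FiniteType k R → IsRegularRing R → ringKrullDim R ≤ 1 → ∀ a : R,
      Literature.AlgebraicGeometry.Resolution.Scheme.HasResolution (AlgebraicGeometry.Spec (.of
        (AdjoinRoot (Polynomial.X ^ p - Polynomial.C a) ⧸
          nilradical (AdjoinRoot (Polynomial.X ^ p - Polynomial.C a))))) := by
  intro p hp k _ _ R _ _ _ _ _ hdim a
  haveI : Fact p.Prime := ⟨hp⟩
  exact hasResolution_localModel_of_ringKrullDim_le_one k hdim a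

/-- **`PicoverLocalModel` when `a` is a `p`-th power**, in the binder form of the crux (all
dimensions): `Spec ((R[T]/(T^p - b^p))_red) ≅ Spec R` is regular. [folklore] -/
theorem picoverLocalModel_of_eq_pow :
    ∀ p : ℕ, p.Prime → ∀ (k : Type) [Field k] [CharP k p] (R : Type) [CommRing R] [IsDomain R]
      [Algebra k R], Algebra.FiniteType k R → IsRegularRing R → ∀ a b : R, a = b ^ p →
      Literature.AlgebraicGeometry.Resolution.Scheme.HasResolution (AlgebraicGeometry.Spec (.of
        (AdjoinRoot (Polynomial.X ^ p - Polynomial.C a) ⧸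
          nilradical (AdjoinRoot (Polynomial.X ^ p - Polynomial.C a))))) := by
  intro p hp k _ _ R _ _ _ _ _ a b hab
  haveI : Fact p.Prime := ⟨hp⟩
  haveI : CharP R p := charP_of_algebra_field k R
  exact hasResolution_localModel_of_eq_pow hab

/-- **The summit implies the crux** (binder form of `PicoverLocalModel` with the summit conjunct
`ResolutionInChar p` as an extra hypothesis): resolution in characteristic `p` resolves every local
model `Spec ((R[T]/(T^p - a))_red)`, a reduced affine `k`-scheme of finite type. (So the crux is a
special case of the summit statement, not an independent strengthening of it.) [folklore] -/
theorem picoverLocalModel_of_resolutionInChar :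
    ∀ p : ℕ, p.Prime → Literature.AlgebraicGeometry.Resolution.ResolutionInChar.{0} p →
      ∀ (k : Type) [Field k] [CharP k p] (R : Type) [CommRing R] [IsDomain R]
      [Algebra k R], Algebra.FiniteType k R → IsRegularRing R → ∀ a : R,
      Literature.AlgebraicGeometry.Resolution.Scheme.HasResolution (AlgebraicGeometry.Spec (.of
        (AdjoinRoot (Polynomial.X ^ p - Polynomial.C a) ⧸
          nilradical (AdjoinRoot (Polynomial.X ^ p - Polynomial.C a))))) := by
  intro p _ h k _ _ R _ _ _ _ _ a
  exact hasResolution_localModel_of_resolutionInChar k h a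

end Crux

end Summit.ResolutionOfSingularities.ResolutionOfSingularities.Theorems
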